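import Literature.Analysis.FunctionSpaces.WeakL1Limits
import Literature.Analysis.FunctionSpaces.WeakCompactnessL1NecessityProofs
import Mathlib.Analysis.Convex.Approximation
import Mathlib.Analysis.Convex.Continuous
import Mathlib.MeasureTheory.Order.Lattice
import HarnessLib

/-!
# Lower semicontinuity of convex integral functionals under weak `L¹` convergence: proof

Analysis/FunctionSpaces proof file for `Literature.Analysis.FunctionSpaces.WeakL1Limits`: the named
fact `Literature.Analysis.FunctionSpaces.lintegral_convex_le_liminf_of_tendstoWeaklyL1`
(Cercignani–Illner–Pulvirenti 1994, §5.3 Step 8, p. 148: "if `F : ℝ → ℝ` is convex and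
`fₙ ⇀ f` in `L¹`, then `∫ F∘f dx ≤ liminf ∫ F∘fₙ dx`", there referred to Dacorogna, LNM 922) is
**discharged**:

* `Literature.Analysis.FunctionSpaces.lintegral_convex_le_liminf_of_tendstoWeaklyL1_holds`.

The second named fact of `WeakL1Limits`, the product-limit lemma
`Literature.Analysis.FunctionSpaces.tendstoWeaklyL1_mul_of_tendsto_ae` (CIP 1994 §5.3 Step 8,
p. 148: "let `fₙ ⇀ f` in `L¹`, `{gₙ} ⊂ L^∞` bounded, `gₙ → g` a.e., then `fₙ gₙ ⇀ f g` in `L¹`"),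
is **discharged** at the end of the file:

* `Literature.Analysis.FunctionSpaces.tendstoWeaklyL1_mul_of_tendsto_ae_holds` — the proved
  reduction `tendstoWeaklyL1_mul_of_tendsto_ae_of_dunfordPettis` (Egorov + equi-integrability,
  in `WeakL1Limits`) fed with the discharged Dunford–Pettis necessity theorem
  `Literature.Analysis.FunctionSpaces.dunfordPettis_necessary_holds`
  (`WeakCompactnessL1NecessityProofs`: Banach–Steinhaus + Vitali–Hahn–Saks), exactly CIP's
  argument "by the Dunford–Pettis criterion and Egorov's theorem".

Proof (the affine-minorant argument). A finite convex function `F ≥ 0` on `ℝ^ι` is continuous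
(`ConvexOn.locallyLipschitz`), hence the pointwise supremum of a sequence of continuous affine
minorants `L k + c k` (`ConvexOn.real_univ_sSup_of_nat_affine_eq`), to which we prepend `0`.
The truncations `G_N = max_{k ≤ N} (L k + c k)` increase to `F`, so by monotone convergence it
suffices to bound `∫_T G_N∘g` for a set `T` of finite measure (`σ`-finiteness). On `T` choose
measurably (`Nat.find`, `measurable_find`) an index `k(x) ≤ N` realising the maximum at `g x`;
expanding `L k v = Σ_i v_i · L k eᵢ` turns `∫_T (L_{k(x)} (fₙ x) + c_{k(x)})` into finitely many
pairings `∫ fₙⁱ φᵢ` with bounded multipliers plus a constant, which converge by the weak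
convergence of each component to `∫_T G_N∘g`; and each of them is `≤ ∫ F∘fₙ` by the minorant
property.

## References

* C. Cercignani, R. Illner, M. Pulvirenti, *The Mathematical Theory of Dilute Gases*, Springer
  (1994), §5.3 Step 8, p. 148.
* B. Dacorogna, *Weak continuity and weak lower semicontinuity of non-linear functionals*,
  LNM 922, Springer (1982).
-/

noncomputable section

open MeasureTheory Filter Topology Set Function
open scoped ENNReal NNReal

namespace Literature.Analysis.FunctionSpaces

variable {α : Type*} [MeasurableSpace α] {μ : Measure α}

/-- `ENNReal.ofReal (∫ f) ≤ ∫⁻ ENNReal.ofReal ∘ f` for every real `f` (both sides discard the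
negative part; the left side is `0` for non-integrable `f`). [folklore] -/
theorem ofReal_integral_le_lintegral_ofReal' (f : α → ℝ) :
    ENNReal.ofReal (∫ a, f a ∂μ) ≤ ∫⁻ a, ENNReal.ofReal (f a) ∂μ := by
  by_cases hf : Integrable f μ
  · calc ENNReal.ofReal (∫ a, f a ∂μ) ≤ ENNReal.ofReal (∫ a, max (f a) 0 ∂μ) :=
          ENNReal.ofReal_le_ofReal (integral_mono hf hf.pos_part fun a => le_max_left _ _)
      _ = ∫⁻ a, ENNReal.ofReal (max (f a) 0) ∂μ :=
          ofReal_integral_eq_lintegral_ofReal hf.pos_part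
            (Eventually.of_forall fun a => le_max_right _ _)
      _ = ∫⁻ a, ENNReal.ofReal (f a) ∂μ := lintegral_congr fun a => by
          rcases le_total (f a) 0 with h | h
          · rw [max_eq_right h, ENNReal.ofReal_zero, ENNReal.ofReal_of_nonpos h]
          · rw [max_eq_left h]
  · rw [integral_undef hf, ENNReal.ofReal_zero]
    exact zero_le

variable {ι : Type*} [Fintype ι]

/-- A nonnegative finite convex function on `ℝ^ι` is the pointwise supremum of a sequence of
continuous affine minorants `v ↦ L k v + c k` starting with the zero function (Hahn–Banach:
`ConvexOn.real_univ_sSup_of_nat_affine_eq`, using the continuity of finite convex functions,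
`ConvexOn.locallyLipschitz`). [folklore] -/
theorem exists_affine_seq_of_convexOn_nonneg {F : (ι → ℝ) → ℝ} (hF : ConvexOn ℝ univ F)
    (hF0 : ∀ u, 0 ≤ F u) :
    ∃ (L : ℕ → (ι → ℝ) →L[ℝ] ℝ) (c : ℕ → ℝ), L 0 = 0 ∧ c 0 = 0 ∧ (∀ k v, L k v + c k ≤ F v) ∧
      ∀ v r, r < F v → ∃ k, r < L k v + c k := by
  have hFc : Continuous F := hF.locallyLipschitz.continuous
  obtain ⟨l, c, hle, hsup⟩ := hF.real_univ_sSup_of_nat_affine_eq hFc.lowerSemicontinuous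
  refine ⟨fun k => if k = 0 then 0 else l (k - 1), fun k => if k = 0 then 0 else c (k - 1),
    if_pos rfl, if_pos rfl, fun k v => ?_, fun v r hr => ?_⟩
  · by_cases hk : k = 0
    · simp [hk, hF0 v]
    · simpa [hk] using hle (k - 1) v
  · have hv : (⨆ i, (⇑(l i) + const (ι → ℝ) (c i))) v = F v := by rw [hsup]
    rw [iSup_apply] at hv
    simp only [Pi.add_apply, const_apply] at hv
    rw [← hv] at hr
    obtain ⟨i, hi⟩ := exists_lt_of_lt_ciSup hr
    exact ⟨i + 1, by simpa using hi⟩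

/-- **Core estimate on a set of finite measure.** With affine minorants `L k + c k ≤ F` of
`F ≥ 0` containing `0`, measurable `g` and `fₙⁱ ⇀ gⁱ` weakly in `L¹`, the truncated functional
`∫_T max_{k ≤ N} (L k (g x) + c k)` is at most `liminf ∫ F∘fₙ` (measurable selection of the
active piece, then weak convergence of finitely many bounded pairings). [folklore] -/
theorem lintegral_indicator_sup_affine_le_liminf {f : ℕ → ι → α → ℝ} {g : ι → α → ℝ}
    {F : (ι → ℝ) → ℝ} (hF0 : ∀ u, 0 ≤ F u) {L : ℕ → (ι → ℝ) →L[ℝ] ℝ} {c : ℕ → ℝ}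
    (hL0 : L 0 = 0) (hc0 : c 0 = 0) (hLF : ∀ k v, L k v + c k ≤ F v)
    (hfi : ∀ n i, Integrable (f n i) μ) (hgi : ∀ i, Integrable (g i) μ)
    (hgm : ∀ i, Measurable (g i)) (hw : ∀ i, TendstoWeaklyL1 (fun n => f n i) (g i) μ)
    {T : Set α} (hT : MeasurableSet T) (hμT : μ T ≠ ∞) (N : ℕ) :
    ∫⁻ x, ENNReal.ofReal (T.indicator (fun x => (Finset.range (N + 1)).sup'
        Finset.nonempty_range_add_one (fun k => L k (fun i => g i x) + c k)) x) ∂μ ≤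
      liminf (fun n => ∫⁻ x, ENNReal.ofReal (F fun i => f n i x) ∂μ) atTop := by
  classical
  set G : α → ℝ := fun x => (Finset.range (N + 1)).sup' Finset.nonempty_range_add_one
    (fun k => L k (fun i => g i x) + c k)
  have hgv : Measurable fun x => fun i => g i x := measurable_pi_lambda _ hgm
  have he_meas : ∀ k, Measurable fun x => L k (fun i => g i x) + c k := fun k =>
    ((L k).continuous.measurable.comp hgv).add_const _
  have hG_meas : Measurable G := Finset.measurable_range_sup'' fun k _ => he_meas k
  have hG0 : ∀ x, 0 ≤ G x := fun x => by
    have h0 : L 0 (fun i => g i x) + c 0 = 0 := by simp [hL0, hc0]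
    rw [← h0]
    exact Finset.le_sup' (fun k => L k (fun i => g i x) + c k) (Finset.mem_range.2 N.succ_pos)
  -- measurable selection of the active affine piece
  have hex : ∀ x, ∃ k, G x = L k (fun i => g i x) + c k := fun x => by
    obtain ⟨k, -, hk⟩ := Finset.exists_mem_eq_sup' Finset.nonempty_range_add_one
      (fun k => L k (fun i => g i x) + c k)
    exact ⟨k, hk⟩
  set sel : α → ℕ := fun x => Nat.find (hex x)
  have hsel_spec : ∀ x, G x = L (sel x) (fun i => g i x) + c (sel x) := fun x =>
    Nat.find_spec (hex x)
  have hsel_le : ∀ x, sel x ≤ N := fun x => by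
    obtain ⟨k, hk, hk'⟩ := Finset.exists_mem_eq_sup' Finset.nonempty_range_add_one
      (fun k => L k (fun i => g i x) + c k)
    exact (Nat.find_min' (hex x) hk').trans (Nat.lt_succ_iff.1 (Finset.mem_range.1 hk))
  have hsel_meas : Measurable sel :=
    measurable_find hex fun k => measurableSet_eq_fun hG_meas (he_meas k)
  -- coordinates: `L k v = Σ_i v_i * L k (u i)`
  set u : ι → ι → ℝ := fun i j => if i = j then 1 else 0
  have hLsum : ∀ k (v : ι → ℝ), L k v = ∑ i, v i * L k (u i) := fun k v => by
    simpa [smul_eq_mul] using LinearMap.pi_apply_eq_sum_univ (L k : (ι → ℝ) →ₗ[ℝ] ℝ) v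
  -- the multipliers
  set one : α → ℝ := T.indicator (fun _ => (1 : ℝ)) with hone
  set φ : ι → α → ℝ := fun i x => one x * L (sel x) (u i) with hφ
  set b : α → ℝ := fun x => one x * c (sel x) with hb
  set R : ι → ℝ := fun i => ∑ k ∈ Finset.range (N + 1), |L k (u i)|
  have hone_abs : ∀ x, |one x| ≤ 1 := fun x => by
    by_cases hx : x ∈ T <;> simp [hone, hx]
  have hone_nn : ∀ x, 0 ≤ one x := fun x => by
    by_cases hx : x ∈ T <;> simp [hone, hx]
  have hmemN : ∀ x, sel x ∈ Finset.range (N + 1) := fun x =>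
    Finset.mem_range.2 (Nat.lt_succ_of_le (hsel_le x))
  have hφ_bdd : ∀ i x, |φ i x| ≤ R i := fun i x => by
    have h1 : |L (sel x) (u i)| ≤ R i :=
      Finset.single_le_sum (f := fun k => |L k (u i)|) (fun k _ => abs_nonneg _) (hmemN x)
    calc |φ i x| = |one x| * |L (sel x) (u i)| := abs_mul _ _
      _ ≤ 1 * R i := mul_le_mul (hone_abs x) h1 (abs_nonneg _) zero_le_one
      _ = R i := one_mul _
  have hone_meas : Measurable one := measurable_const.indicator hT
  have hφ_meas : ∀ i, Measurable (φ i) := fun i =>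
    hone_meas.mul ((measurable_from_nat (f := fun k => L k (u i))).comp hsel_meas)
  have hcsel_meas : Measurable fun x => c (sel x) := (measurable_from_nat (f := c)).comp hsel_meas
  have hone_int : Integrable one μ := by
    rw [hone, integrable_indicator_iff hT]
    exact integrableOn_const hμT
  have hb_int : Integrable b μ :=
    hone_int.mul_bdd hcsel_meas.aestronglyMeasurable (Eventually.of_forall fun x => by
      rw [Real.norm_eq_abs]
      exact Finset.single_le_sum (f := fun k => |c k|) (fun k _ => abs_nonneg _) (hmemN x))
  -- pointwise and integrated expansions
  have hpt : ∀ (w : ι → α → ℝ) (x : α),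
      one x * (L (sel x) (fun i => w i x) + c (sel x)) = ∑ i, w i x * φ i x + b x := by
    intro w x
    rw [hLsum, mul_add, Finset.mul_sum]
    simp only [hφ, hb]
    congr 1
    exact Finset.sum_congr rfl fun i _ => by ring
  have hwφ : ∀ (w : ι → α → ℝ), (∀ i, Integrable (w i) μ) →
      ∀ i, Integrable (fun x => w i x * φ i x) μ := fun w hwi i =>
    (hwi i).mul_bdd (hφ_meas i).aestronglyMeasurable (Eventually.of_forall fun x => by
      rw [Real.norm_eq_abs]; exact hφ_bdd i x)
  have hint : ∀ (w : ι → α → ℝ), (∀ i, Integrable (w i) μ) →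
      ∫ x, one x * (L (sel x) (fun i => w i x) + c (sel x)) ∂μ =
        ∑ i, ∫ x, w i x * φ i x ∂μ + ∫ x, b x ∂μ := by
    intro w hwi
    simp_rw [hpt w]
    rw [integral_add (integrable_finsetSum _ fun i _ => hwφ w hwi i) hb_int,
      integral_finsetSum _ fun i _ => hwφ w hwi i]
  -- weak convergence of the finitely many pairings
  have hlim : Tendsto (fun n => ∫ x, one x * (L (sel x) (fun i => f n i x) + c (sel x)) ∂μ) atTop
      (𝓝 (∫ x, one x * (L (sel x) (fun i => g i x) + c (sel x)) ∂μ)) := by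
    have h1 : ∀ i, Tendsto (fun n => ∫ x, f n i x * φ i x ∂μ) atTop (𝓝 (∫ x, g i x * φ i x ∂μ)) :=
      fun i => hw i (φ i) (R i) (hφ_meas i).aestronglyMeasurable (Eventually.of_forall (hφ_bdd i))
    have h2 := (tendsto_finsetSum Finset.univ fun i _ => h1 i).add_const (∫ x, b x ∂μ)
    have h3 : (fun n => ∫ x, one x * (L (sel x) (fun i => f n i x) + c (sel x)) ∂μ) =
        fun n => ∑ i, ∫ x, f n i x * φ i x ∂μ + ∫ x, b x ∂μ :=
      funext fun n => hint (fun i => f n i) (hfi n)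
    rw [h3, hint g hgi]
    exact h2
  -- each pairing is below `∫ F∘fₙ`
  have hstep : ∀ n, ENNReal.ofReal (∫ x, one x * (L (sel x) (fun i => f n i x) + c (sel x)) ∂μ) ≤
      ∫⁻ x, ENNReal.ofReal (F fun i => f n i x) ∂μ := fun n =>
    (ofReal_integral_le_lintegral_ofReal' _).trans (lintegral_mono fun x =>
      ENNReal.ofReal_le_ofReal (by
        by_cases hx : x ∈ T
        · simp only [hone, indicator_of_mem hx, one_mul]
          exact hLF _ _
        · simp only [hone, indicator_of_notMem hx, zero_mul]
          exact hF0 _))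
  -- the left-hand side is the limit of the pairings
  have hh_int : Integrable (fun x => one x * (L (sel x) (fun i => g i x) + c (sel x))) μ := by
    have : (fun x => one x * (L (sel x) (fun i => g i x) + c (sel x))) =
        fun x => ∑ i, g i x * φ i x + b x := funext (hpt g)
    rw [this]
    exact (integrable_finsetSum _ fun i _ => hwφ g hgi i).add hb_int
  have hlhs : ∫⁻ x, ENNReal.ofReal (T.indicator G x) ∂μ =
      ENNReal.ofReal (∫ x, one x * (L (sel x) (fun i => g i x) + c (sel x)) ∂μ) := by
    rw [ofReal_integral_eq_lintegral_ofReal hh_int (Eventually.of_forall fun x => by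
      show (0 : ℝ) ≤ one x * (L (sel x) (fun i => g i x) + c (sel x))
      rw [← hsel_spec x]; exact mul_nonneg (hone_nn x) (hG0 x))]
    refine lintegral_congr fun x => ?_
    by_cases hx : x ∈ T
    · simp only [hone, indicator_of_mem hx, one_mul]
      exact congrArg _ (hsel_spec x)
    · simp only [hone, indicator_of_notMem hx, zero_mul]
  show ∫⁻ x, ENNReal.ofReal (T.indicator G x) ∂μ ≤ _
  rw [hlhs, ← ((ENNReal.continuous_ofReal.tendsto _).comp hlim).liminf_eq]
  exact liminf_le_liminf (Eventually.of_forall hstep)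

/-- The fact for measurable limits `g` (monotone convergence over the truncations
`1_{Tₘ} · max_{k ≤ m} (L k + c k) ↑ F`, `Tₘ` the spanning sets, on top of
`lintegral_indicator_sup_affine_le_liminf`). [folklore] -/
theorem lintegral_convex_le_liminf_of_tendstoWeaklyL1_of_measurable [SigmaFinite μ]
    {f : ℕ → ι → α → ℝ} {g : ι → α → ℝ} {F : (ι → ℝ) → ℝ} (hF : ConvexOn ℝ univ F)
    (hF0 : ∀ u, 0 ≤ F u) (hfi : ∀ n i, Integrable (f n i) μ) (hgi : ∀ i, Integrable (g i) μ)
    (hgm : ∀ i, Measurable (g i)) (hw : ∀ i, TendstoWeaklyL1 (fun n => f n i) (g i) μ) :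
    ∫⁻ x, ENNReal.ofReal (F fun i => g i x) ∂μ ≤
      liminf (fun n => ∫⁻ x, ENNReal.ofReal (F fun i => f n i x) ∂μ) atTop := by
  obtain ⟨L, c, hL0, hc0, hLF, hsup⟩ := exists_affine_seq_of_convexOn_nonneg hF hF0
  set G : ℕ → α → ℝ := fun N x => (Finset.range (N + 1)).sup' Finset.nonempty_range_add_one
    (fun k => L k (fun i => g i x) + c k)
  set H : ℕ → α → ℝ≥0∞ := fun m x =>
    ENNReal.ofReal ((spanningSets μ m).indicator (G m) x) with hH
  have hkey : ∀ m, ∫⁻ x, H m x ∂μ ≤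
      liminf (fun n => ∫⁻ x, ENNReal.ofReal (F fun i => f n i x) ∂μ) atTop := fun m =>
    lintegral_indicator_sup_affine_le_liminf hF0 hL0 hc0 hLF hfi hgi hgm hw
      (measurableSet_spanningSets μ m) (measure_spanningSets_lt_top μ m).ne m
  have hgv : Measurable fun x => fun i => g i x := measurable_pi_lambda _ hgm
  have he_meas : ∀ k, Measurable fun x => L k (fun i => g i x) + c k := fun k =>
    ((L k).continuous.measurable.comp hgv).add_const _
  have hG_meas : ∀ N, Measurable (G N) := fun N =>
    Finset.measurable_range_sup'' fun k _ => he_meas k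
  have hG0 : ∀ N x, 0 ≤ G N x := fun N x => by
    have h0 : L 0 (fun i => g i x) + c 0 = 0 := by simp [hL0, hc0]
    rw [← h0]
    exact Finset.le_sup' (fun k => L k (fun i => g i x) + c k) (Finset.mem_range.2 N.succ_pos)
  have hGmono : ∀ x, Monotone fun N => G N x := fun x N N' hNN' =>
    Finset.sup'_mono _ (Finset.range_mono (Nat.succ_le_succ hNN')) _
  have hGle : ∀ N x, G N x ≤ F fun i => g i x := fun N x =>
    Finset.sup'_le _ _ fun k _ => hLF k _
  have hGtend : ∀ x, Tendsto (fun N => G N x) atTop (𝓝 (F fun i => g i x)) := fun x => by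
    rw [tendsto_order]
    refine ⟨fun r hr => ?_, fun r hr => Eventually.of_forall fun N => (hGle N x).trans_lt hr⟩
    obtain ⟨k, hk⟩ := hsup _ r hr
    refine eventually_atTop.2 ⟨k, fun N hN => hk.trans_le ?_⟩
    exact Finset.le_sup' (fun k => L k (fun i => g i x) + c k)
      (Finset.mem_range.2 (Nat.lt_succ_of_le hN))
  have hHmono : Monotone H := by
    intro m m' hmm' x
    simp only [hH]
    refine ENNReal.ofReal_le_ofReal ?_
    by_cases hx : x ∈ spanningSets μ m
    · rw [indicator_of_mem hx, indicator_of_mem (monotone_spanningSets μ hmm' hx)]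
      exact hGmono x hmm'
    · rw [indicator_of_notMem hx]
      exact indicator_nonneg (fun y _ => hG0 m' y) x
  have hHsup : ∀ x, ⨆ m, H m x = ENNReal.ofReal (F fun i => g i x) := fun x => by
    have h1 : Tendsto (fun m => H m x) atTop (𝓝 (⨆ m, H m x)) :=
      tendsto_atTop_iSup fun m m' h => hHmono h x
    have h3 : (fun m => ENNReal.ofReal (G m x)) =ᶠ[atTop] fun m => H m x := by
      filter_upwards [eventually_mem_spanningSets μ x] with m hm
      simp only [hH, indicator_of_mem hm]
    have h2 : Tendsto (fun m => H m x) atTop (𝓝 (ENNReal.ofReal (F fun i => g i x))) :=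
      ((ENNReal.continuous_ofReal.tendsto _).comp (hGtend x)).congr' h3
    exact tendsto_nhds_unique h1 h2
  have hHmeas : ∀ m, Measurable (H m) := fun m =>
    ENNReal.measurable_ofReal.comp ((hG_meas m).indicator (measurableSet_spanningSets μ m))
  calc ∫⁻ x, ENNReal.ofReal (F fun i => g i x) ∂μ = ∫⁻ x, ⨆ m, H m x ∂μ :=
        lintegral_congr fun x => (hHsup x).symm
    _ = ⨆ m, ∫⁻ x, H m x ∂μ := lintegral_iSup hHmeas hHmono
    _ ≤ _ := iSup_le hkey

/-- **CIP 1994 §5.3 Step 8, discharged**: lower semicontinuity of `∫ F∘·` for nonnegative convex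
`F` on `ℝ^ι` under componentwise weak `L¹` convergence on a `σ`-finite space (reduction to
measurable representatives of the limit, then
`lintegral_convex_le_liminf_of_tendstoWeaklyL1_of_measurable`).
[cite: CIPDiluteGases1994, §5.3 Step 8 (p. 148)] -/
theorem lintegral_convex_le_liminf_of_tendstoWeaklyL1_holds :
    lintegral_convex_le_liminf_of_tendstoWeaklyL1 := by
  intro α _ μ _ ι _ f g F hF hF0 hfi hgi hw
  set g' : ι → α → ℝ := fun i => (hgi i).1.mk (g i)
  have hgg' : ∀ i, g i =ᵐ[μ] g' i := fun i => (hgi i).1.ae_eq_mk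
  have hg'm : ∀ i, Measurable (g' i) := fun i => (hgi i).1.stronglyMeasurable_mk.measurable
  have hg'i : ∀ i, Integrable (g' i) μ := fun i => (hgi i).congr (hgg' i)
  have hw' : ∀ i, TendstoWeaklyL1 (fun n => f n i) (g' i) μ := fun i φ C hφ hC => by
    have h := hw i φ C hφ hC
    have e : ∫ x, g i x * φ x ∂μ = ∫ x, g' i x * φ x ∂μ :=
      integral_congr_ae (by filter_upwards [hgg' i] with x hx; rw [hx])
    rwa [e] at h
  have hall : ∀ᵐ x ∂μ, ∀ i, g i x = g' i x := ae_all_iff.2 fun i => hgg' i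
  calc ∫⁻ x, ENNReal.ofReal (F fun i => g i x) ∂μ = ∫⁻ x, ENNReal.ofReal (F fun i => g' i x) ∂μ :=
        lintegral_congr_ae (hall.mono fun x hx => by simp only [hx])
    _ ≤ _ := lintegral_convex_le_liminf_of_tendstoWeaklyL1_of_measurable hF hF0 hfi hg'i hg'm hw'

/-! ## Products of weakly and a.e. convergent sequences (CIP 1994 §5.3 Step 8) -/

/-- **CIP 1994 §5.3 Step 8, product-limit lemma, discharged**: on a `σ`-finite measure space, if
`fₙ ⇀ g` weakly in `L¹` (`fₙ, g` integrable), `|ψₙ| ≤ M` a.e. and `ψₙ → ψ'` a.e., then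
`fₙ ψₙ ⇀ g ψ'` weakly in `L¹`. As printed (p. 148) only the weak convergence of `(fₙ)` is
assumed: its boundedness, equi-integrability and uniform tightness are supplied by the necessity
half of the Dunford–Pettis theorem (`dunfordPettis_necessary_holds`), after which the
equi-integrable form `TendstoWeaklyL1.mul_of_tendsto_ae` (Egorov's theorem) applies, via the
reduction `tendstoWeaklyL1_mul_of_tendsto_ae_of_dunfordPettis`.
[cite: CIPDiluteGases1994, §5.3 Step 8 (p. 148)] -/
theorem tendstoWeaklyL1_mul_of_tendsto_ae_holds : tendstoWeaklyL1_mul_of_tendsto_ae :=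
  tendstoWeaklyL1_mul_of_tendsto_ae_of_dunfordPettis dunfordPettis_necessary_holds

end Literature.Analysis.FunctionSpaces
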